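import Literature.Analysis.FluidPDE.NSLocalAnalyticityRadiusData
import Literature.Analysis.FluidPDE.NewtonGradKernelComplex
import Literature.Analysis.FluidPDE.HeatPotentialComplex
import Literature.Analysis.FluidPDE.LerayHeatForcingComplex
import Literature.Analysis.FluidPDE.NewtonGradientPotential
import HarnessLib

/-!
# Bradshaw–Grujić–Kukavica local analyticity radius: the complex continuation of the datum

Analysis/FluidPDE definitions-layer file (namespace `Literature.Analysis.FluidPDE.BGK2015`) for
the proof of the named fact
`Literature.Analysis.FluidPDE.bradshawGrujicKukavica2015_local_analyticity_radius`
(Bradshaw–Grujić–Kukavica 2015, Thm. 2.3, §4). The datum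
`DATA(t) = b(t) + e^{(t-s₀)Δ}a(s₀) - B_{s₀}(v,(1-χ)ũ)(t) - B_{s₀}(2∇χ,ũ)(t) + F(t)` of the
localised Picard scheme (`NSLocalAnalyticityRadiusData.lean`) is continued term by term:

  `DATA_ℂ(t, ζ) = ∇N_ℂ[∇χ·u(t)](ζ) + e^{(t-s₀)Δ}_ℂ a(s₀)(ζ) - B^♭_{s₀}(v,(1-χ)ũ)(t,ζ)
                  - B^♭_{s₀}(2∇χ,ũ)(t,ζ) + F_ℂ(t,ζ)`       (`locDataC`)

(`newtonGradPotentialC`, `heatPotentialC`, `oseenDuhamelFlatC`, `lerayHeatForcingC`), and we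
prove, for the geometry `R = 12` (cut-off `≡ 1` on `B̄(x₁,8)`, supported in `B̄(x₁,9)`; targets
`x ∈ B(x₁,2)`, so that every annular source keeps distance `≥ 6`):

* **real restriction**: `DATA_ℂ(t, cx x) = cx DATA(t, x)` for all real `x`
  (`locDataC_complexify`);
* **the quantitative bound** `‖DATA_ℂ(t, cx x + i cx y)‖ ≤ A (M_u + M_u² + M_p)` at admissible
  points `x ∈ B(x₁,2)`, `‖y‖ ≤ min(1, √(t-s₀))`, with `A` depending only on bounds `L₁, L₂` for
  `∇χ, Δχ` — `M_u` a bound for `u` on `[s₀,t₁] × B(x₁,11)`, `M_p` a bound for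
  `∫_{B̄(x₁,9)} |p(s)|` (`exists_norm_locDataC_le`);
* **holomorphy** of `DATA_ℂ(t, ·)` on every open set of admissible points
  (`differentiableOn_locDataC`).

## References

* Z. Bradshaw, Z. Grujić, I. Kukavica, J. Differential Equations 259 (2015), §4, (4.2)–(4.4).
  [BradshawGrujicKukavica2015]
* A. J. Majda, A. L. Bertozzi, *Vorticity and Incompressible Flow* (2002), §4.1.3 (4.38).
  [MajdaBertozziCUP2002]
-/

noncomputable section

open MeasureTheory Set Function Filter Metric Real
open _root_.Topology
open scoped ENNReal NNReal ContDiff Laplacian InnerProductSpace RealInnerProductSpace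
open Literature.Analysis.FunctionSpaces.EuclideanSpace (complexify complexify_apply norm_complexify
  complexify_injective continuous_complexify)

namespace Literature.Analysis.FluidPDE

open UnboundedOperators (heatKernel heatExtension)

namespace BGK2015

variable {x₁ : EuclideanSpace ℝ (Fin 3)} {δ R : ℝ}
  {u : ℝ → EuclideanSpace ℝ (Fin 3) → EuclideanSpace ℝ (Fin 3)}
  {p : ℝ → EuclideanSpace ℝ (Fin 3) → ℝ} {χ : EuclideanSpace ℝ (Fin 3) → ℝ}

/-! ### The continued datum -/

/-- **The complex continuation of the datum** of the localised Picard scheme,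
`DATA_ℂ(t,ζ) = ∇N_ℂ[∇χ·u(t)](ζ) + e^{(t-s₀)Δ}_ℂ a(s₀)(ζ) - B^♭_{s₀}(v,(1-χ)ũ)(t,ζ)
 - B^♭_{s₀}(2∇χ,ũ)(t,ζ) + F_ℂ(t,ζ)`. [cite: BradshawGrujicKukavica2015, §4 (4.2)–(4.4)] -/
def locDataC (x₁ : EuclideanSpace ℝ (Fin 3)) (R : ℝ) (χ : EuclideanSpace ℝ (Fin 3) → ℝ)
    (u : ℝ → EuclideanSpace ℝ (Fin 3) → EuclideanSpace ℝ (Fin 3))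
    (p : ℝ → EuclideanSpace ℝ (Fin 3) → ℝ) (s₀ t : ℝ) (ζ : EuclideanSpace ℂ (Fin 3)) :
    EuclideanSpace ℂ (Fin 3) :=
  newtonGradPotentialC (locDivergence χ u t) ζ
    + heatPotentialC (Real.sqrt (t - s₀)) (locSolPart χ u s₀) ζ
    - oseenDuhamelFlatC s₀ (locVelocity χ u) (locFarVelocity x₁ R χ u) t ζ
    - oseenDuhamelFlatC s₀ (fun _ y => (2 : ℝ) • gradient χ y) (locExtension x₁ R u) t ζ
    + lerayHeatForcingC s₀ (locForce χ u p) t ζ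

/-- Unfolding lemma. [folklore] -/
theorem locDataC_apply (s₀ t : ℝ) (ζ : EuclideanSpace ℂ (Fin 3)) :
    locDataC x₁ R χ u p s₀ t ζ = newtonGradPotentialC (locDivergence χ u t) ζ
      + heatPotentialC (Real.sqrt (t - s₀)) (locSolPart χ u s₀) ζ
      - oseenDuhamelFlatC s₀ (locVelocity χ u) (locFarVelocity x₁ R χ u) t ζ
      - oseenDuhamelFlatC s₀ (fun _ y => (2 : ℝ) • gradient χ y) (locExtension x₁ R u) t ζ
      + lerayHeatForcingC s₀ (locForce χ u p) t ζ := rfl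

/-! ### Real restriction -/

/-- **`DATA_ℂ` restricts to `DATA` at real points**: for `-δ < s₀ < t < R²` and every real `x`,
`locDataC … t (cx x) = cx (locData … t x)`. [folklore] -/
theorem locDataC_complexify (hsol : IsCylinderSolution x₁ δ R u p) (hχ : IsLocCutoff x₁ R χ)
    {s₀ t : ℝ} (hs₀ : -δ < s₀) (hst : s₀ < t) (htR : t < R ^ 2) (x : EuclideanSpace ℝ (Fin 3)) :
    locDataC x₁ R χ u p s₀ t (complexify x) = complexify (locData x₁ R χ u p s₀ t x) := by
  have ht : t ∈ Ioo (-δ) (R ^ 2) := ⟨hs₀.trans hst, htR⟩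
  -- `T1`: the gradient part
  have h1 : newtonGradPotentialC (locDivergence χ u t) (complexify x) = complexify (locGradPart χ u t x) := by
    rw [newtonGradPotentialC_complexify (contDiff_locDivergence hsol hχ ht).continuous
      (hasCompactSupport_locDivergence hχ), locGradPart_eq_sum_newtonGradPotential hsol hχ ht x]
  -- `T2`: the caloric datum
  have h2 : heatPotentialC (Real.sqrt (t - s₀)) (locSolPart χ u s₀) (complexify x) =
      complexify (locDatum χ u s₀ t x) := by
    rw [heatPotentialC_sqrt_complexify _ (sub_pos.2 hst), locDatum_eq, heatFlow_of_pos _ (sub_pos.2 hst)]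
  -- `T4`: the forcing
  have h4 : lerayHeatForcingC s₀ (locForce χ u p) t (complexify x) = complexify (locForcing χ u p s₀ t x) := by
    rw [lerayHeatForcingC_complexify (fun s hs => contDiff_locForce hsol hχ ⟨hs₀.trans hs.1, hs.2.trans htR⟩)
      (fun s _ => hasCompactSupport_locForce hχ), locForcing_apply]
    congr 1
    refine setIntegral_congr_fun measurableSet_Ioo fun s hs => ?_
    rw [locProjForce_eq, heatFlow_of_pos _ (sub_pos.2 hs.2)]
  rw [locDataC_apply, locData_apply, h1, h2, oseenDuhamelFlatC_complexify, oseenDuhamelFlatC_complexify, h4]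
  simp only [map_add, map_sub]

/-! ### Geometry of the sources (`R = 12`) -/

section Geometry

variable (hχ : IsLocCutoff x₁ 12 χ)
include hχ

/-- The far part vanishes on `B̄(x₁, 8)`. [folklore] -/
theorem locFarVelocity_eq_zero_of_mem' {y : EuclideanSpace ℝ (Fin 3)} (hy : y ∈ closedBall x₁ 8) (t : ℝ) :
    locFarVelocity x₁ 12 χ u t y = 0 :=
  locFarVelocity_eq_zero_of_mem hχ (by norm_num; exact hy) t

/-- `∇χ` vanishes on `B(x₁, 8)`. [folklore] -/
theorem gradient_cutoff_eq_zero_of_mem {y : EuclideanSpace ℝ (Fin 3)} (hy : y ∈ ball x₁ 8) :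
    gradient χ y = 0 := by
  rw [gradient, hχ.fderiv_eq_zero_of_mem (by norm_num; exact hy), map_zero]

/-- `∇χ·u` vanishes on `B(x₁, 8)`. [folklore] -/
theorem locDivergence_eq_zero_of_mem' {y : EuclideanSpace ℝ (Fin 3)} (hy : y ∈ ball x₁ 8) (t : ℝ) :
    locDivergence χ u t y = 0 :=
  locDivergence_eq_zero_of_mem hχ (by norm_num; exact hy)

/-- `f₀` vanishes on `B(x₁, 8)` (`χ ≡ 1` near each point there). [folklore] -/
theorem locForce_eq_zero_of_mem {y : EuclideanSpace ℝ (Fin 3)} (hy : y ∈ ball x₁ 8) (t : ℝ) :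
    locForce χ u p t y = 0 := by
  have hy' : y ∈ ball x₁ ((12 : ℝ) - 4) := by norm_num; exact hy
  have hev : χ =ᶠ[𝓝 y] fun _ => (1 : ℝ) := by
    filter_upwards [isOpen_ball.mem_nhds hy'] with z hz
    exact hχ.eq_one z (ball_subset_closedBall hz)
  have hΔ : (Δ χ) y = 0 := by
    have h := (InnerProductSpace.laplacian_congr_nhds hev).self_of_nhds
    rw [h, InnerProductSpace.laplacian_const]
    rfl
  rw [locForce_apply, hΔ, hχ.fderiv_eq_zero_of_mem hy', gradient_cutoff_eq_zero_of_mem hχ hy]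
  simp

/-- **Distances**: a source point off `B(x₁, 8)` keeps distance `≥ 6` from every target
`x ∈ B(x₁, 2)`. [folklore] -/
theorem dist_source_ge {x w : EuclideanSpace ℝ (Fin 3)} (hx : x ∈ ball x₁ 2) (hw : w ∉ ball x₁ 8) :
    (6 : ℝ) ≤ ‖x - w‖ := by
  have _ := hχ
  rw [mem_ball, dist_eq_norm] at hx
  rw [mem_ball, dist_eq_norm, not_lt] at hw
  have h := norm_sub_le_norm_sub_add_norm_sub w x x₁
  rw [norm_sub_rev w x] at h
  linarith

end Geometry

/-! ### Sizes of the sources (`R = 12`) -/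

section Sizes

variable (hsol : IsCylinderSolution x₁ δ 12 u p) (hχ : IsLocCutoff x₁ 12 χ) {s₀ t₁ : ℝ}
  (hI : Icc s₀ t₁ ⊆ Ioo (-δ) ((12 : ℝ) ^ 2))
  {L₁ L₂ Mu Mp : ℝ} (hL₁0 : 0 ≤ L₁) (hL₁ : ∀ y, ‖gradient χ y‖ ≤ L₁) (hL₂ : ∀ y, |(Δ χ) y| ≤ L₂)
  (hMu0 : 0 ≤ Mu) (hMu : ∀ s ∈ Icc s₀ t₁, ∀ y ∈ ball x₁ 11, ‖u s y‖ ≤ Mu)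
  (hMp : ∀ s ∈ Icc s₀ t₁, ∫ y in closedBall x₁ 9, |p s y| ≤ Mp)

include hχ in
/-- `|Dχ(y) a| ≤ L₁ ‖a‖`. [folklore] -/
theorem abs_fderiv_cutoff_le (hL₁ : ∀ y, ‖gradient χ y‖ ≤ L₁) (y a : EuclideanSpace ℝ (Fin 3)) :
    |fderiv ℝ χ y a| ≤ L₁ * ‖a‖ := by
  have _ := hχ
  have h : fderiv ℝ χ y a = ⟪gradient χ y, a⟫ := by
    rw [gradient, InnerProductSpace.toDual_symm_apply]
  rw [h]
  exact (abs_real_inner_le_norm _ _).trans (mul_le_mul_of_nonneg_right (hL₁ y) (norm_nonneg _))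

include hχ hMu in
/-- `‖v(s, y)‖ ≤ M_u` on `[s₀, t₁] × ℝ³`. [folklore] -/
theorem norm_locVelocity_le' {s : ℝ} (hs : s ∈ Icc s₀ t₁) (y : EuclideanSpace ℝ (Fin 3)) :
    ‖locVelocity χ u s y‖ ≤ Mu := by
  have hMu0 : 0 ≤ Mu := (norm_nonneg _).trans (hMu s hs x₁ (mem_ball_self (by norm_num)))
  by_cases hy : y ∈ tsupport χ
  · have hy' : y ∈ ball x₁ 11 := (closedBall_subset_ball (by norm_num)) (hχ.tsupport_subset hy)
    rw [locVelocity_apply, norm_smul, Real.norm_eq_abs]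
    calc |χ y| * ‖u s y‖ ≤ 1 * Mu := mul_le_mul (hχ.abs_le_one y) (hMu s hs y hy') (norm_nonneg _) zero_le_one
      _ = Mu := one_mul _
  · rw [locVelocity_eq_zero_of_notMem hy, norm_zero]
    exact hMu0

include hMu in
/-- `‖ũ(s, y)‖ ≤ M_u` on `[s₀, t₁] × ℝ³`. [folklore] -/
theorem norm_locExtension_le' {s : ℝ} (hs : s ∈ Icc s₀ t₁) (y : EuclideanSpace ℝ (Fin 3)) :
    ‖locExtension x₁ 12 u s y‖ ≤ Mu := by
  have hMu0 : 0 ≤ Mu := (norm_nonneg _).trans (hMu s hs x₁ (mem_ball_self (by norm_num)))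
  by_cases hy : y ∈ ball x₁ ((12 : ℝ) - 2)
  · rw [locExtension_of_mem hy]
    exact hMu s hs y ((ball_subset_ball (by norm_num)) hy)
  · rw [locExtension_of_notMem hy, norm_zero]
    exact hMu0

include hχ hMu in
/-- `‖(1-χ)ũ(s, y)‖ ≤ M_u`. [folklore] -/
theorem norm_locFarVelocity_le' {s : ℝ} (hs : s ∈ Icc s₀ t₁) (y : EuclideanSpace ℝ (Fin 3)) :
    ‖locFarVelocity x₁ 12 χ u s y‖ ≤ Mu :=
  (norm_locFarVelocity_le hχ s y).trans (norm_locExtension_le' hMu hs y)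

include hχ hL₁ in
/-- `‖2∇χ(y)‖ ≤ 2L₁`. [folklore] -/
theorem norm_two_smul_gradient_le (y : EuclideanSpace ℝ (Fin 3)) : ‖(2 : ℝ) • gradient χ y‖ ≤ 2 * L₁ := by
  have _ := hχ
  rw [norm_smul, Real.norm_eq_abs, abs_of_pos two_pos]
  exact mul_le_mul_of_nonneg_left (hL₁ y) zero_le_two

include hχ hL₁ hMu in
/-- `|∇χ·u(s, y)| ≤ L₁ M_u` on `[s₀, t₁] × ℝ³`. [folklore] -/
theorem abs_locDivergence_le {s : ℝ} (hs : s ∈ Icc s₀ t₁) (y : EuclideanSpace ℝ (Fin 3)) :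
    |locDivergence χ u s y| ≤ L₁ * Mu := by
  have hMu0 : 0 ≤ Mu := (norm_nonneg _).trans (hMu s hs x₁ (mem_ball_self (by norm_num)))
  have hL₁0 : 0 ≤ L₁ := (norm_nonneg _).trans (hL₁ x₁)
  by_cases hy : y ∈ tsupport χ
  · have hy' : y ∈ ball x₁ 11 := (closedBall_subset_ball (by norm_num)) (hχ.tsupport_subset hy)
    rw [locDivergence_apply]
    exact (abs_fderiv_cutoff_le hχ hL₁ y _).trans (mul_le_mul_of_nonneg_left (hMu s hs y hy') hL₁0)
  · rw [locDivergence_apply, fderiv_of_notMem_tsupport ℝ hy]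
    rw [_root_.zero_apply, abs_zero]
    positivity

include hχ hL₁ hL₂ hMu in
/-- **Pointwise size of the commutator force**:
`‖f₀(s, y)‖ ≤ L₂ M_u + L₁ M_u² + L₁ |p(s, y)|` on `[s₀, t₁] × ℝ³`. [folklore] -/
theorem norm_locForce_le' {s : ℝ} (hs : s ∈ Icc s₀ t₁) (y : EuclideanSpace ℝ (Fin 3)) :
    ‖locForce χ u p s y‖ ≤ L₂ * Mu + L₁ * Mu ^ 2 + L₁ * |p s y| := by
  have hMu0 : 0 ≤ Mu := (norm_nonneg _).trans (hMu s hs x₁ (mem_ball_self (by norm_num)))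
  have hL₁0 : 0 ≤ L₁ := (norm_nonneg _).trans (hL₁ x₁)
  have hL₂0 : 0 ≤ L₂ := (abs_nonneg _).trans (hL₂ x₁)
  by_cases hy : y ∈ tsupport χ
  · have hy' : y ∈ ball x₁ 11 := (closedBall_subset_ball (by norm_num)) (hχ.tsupport_subset hy)
    have hu := hMu s hs y hy'
    rw [locForce_apply]
    refine (norm_add₃_le).trans ?_
    rw [norm_smul, norm_smul, norm_smul, Real.norm_eq_abs, Real.norm_eq_abs, Real.norm_eq_abs]
    have h1 : |(Δ χ) y| * ‖u s y‖ ≤ L₂ * Mu := mul_le_mul (hL₂ y) hu (norm_nonneg _) hL₂0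
    have h2 : |fderiv ℝ χ y (u s y)| * ‖u s y‖ ≤ L₁ * Mu ^ 2 := by
      calc |fderiv ℝ χ y (u s y)| * ‖u s y‖ ≤ (L₁ * ‖u s y‖) * ‖u s y‖ :=
            mul_le_mul_of_nonneg_right (abs_fderiv_cutoff_le hχ hL₁ y _) (norm_nonneg _)
        _ ≤ (L₁ * Mu) * Mu := mul_le_mul (mul_le_mul_of_nonneg_left hu hL₁0) hu (norm_nonneg _) (by positivity)
        _ = L₁ * Mu ^ 2 := by ring
    have h3 : |p s y| * ‖gradient χ y‖ ≤ L₁ * |p s y| := by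
      rw [mul_comm]; exact mul_le_mul_of_nonneg_right (hL₁ y) (abs_nonneg _)
    linarith
  · obtain ⟨-, h2, h3, h4⟩ := (hχ.eventually_derivs_eq_zero hy).self_of_nhds
    have h0 : locForce χ u p s y = 0 := by simp [locForce_apply, h2, h3, h4]
    rw [h0, norm_zero]
    positivity

include hsol hχ hI hL₁ hL₂ hMu hMp in
/-- **`L¹` size of the commutator force**: for `s ∈ [s₀, t₁]`,
`∫ ‖f₀(s)‖ ≤ (L₂ M_u + L₁ M_u²) |B̄(x₁,9)| + L₁ M_p`. [folklore] -/
theorem integral_norm_locForce_le' {s : ℝ} (hs : s ∈ Icc s₀ t₁) :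
    ∫ y, ‖locForce χ u p s y‖ ≤
      (L₂ * Mu + L₁ * Mu ^ 2) * (volume (closedBall x₁ 9)).toReal + L₁ * Mp := by
  set K : Set (EuclideanSpace ℝ (Fin 3)) := closedBall x₁ 9 with hK
  have hKc : IsCompact K := isCompact_closedBall _ _
  have hKvol : volume K < (⊤ : ℝ≥0∞) := hKc.measure_lt_top
  have hL₁0 : 0 ≤ L₁ := (norm_nonneg _).trans (hL₁ x₁)
  have hsI := hI hs
  have hsupp : tsupport (locForce χ u p s) ⊆ K := by
    have h := tsupport_locForce_subset hχ (u := u) (p := p) (t := s)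
    norm_num at h; exact h
  have h0 : ∀ y ∉ K, ‖locForce χ u p s y‖ = 0 := fun y hy => by
    rw [image_eq_zero_of_notMem_tsupport fun h => hy (hsupp h), norm_zero]
  rw [← setIntegral_eq_integral_of_forall_compl_eq_zero h0]
  -- integrability on `K`
  have hfi : IntegrableOn (fun y => ‖locForce χ u p s y‖) K :=
    ((contDiff_locForce hsol hχ hsI).continuous.norm).continuousOn.integrableOn_compact hKc
  have hpc : ContinuousOn (fun y => |p s y|) K := by
    have h1 : ContinuousOn (uncurry p) (Ioo (-δ) ((12 : ℝ) ^ 2) ×ˢ ball x₁ 12) :=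
      hsol.smooth_pressure.continuousOn
    have h2 : ContinuousOn (fun y => p s y) K := by
      refine (h1.comp (continuousOn_const.prodMk continuousOn_id) fun y hy => ⟨hsI, ?_⟩)
      exact (closedBall_subset_ball (by norm_num)) hy
    exact h2.abs
  have hpi : IntegrableOn (fun y => |p s y|) K := hpc.integrableOn_compact hKc
  have hbi : IntegrableOn (fun y => L₂ * Mu + L₁ * Mu ^ 2 + L₁ * |p s y|) K :=
    (integrableOn_const hKvol.ne).add (hpi.const_mul _)
  have hci : IntegrableOn (fun _ : EuclideanSpace ℝ (Fin 3) => L₂ * Mu + L₁ * Mu ^ 2) K :=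
    integrableOn_const hKvol.ne
  calc ∫ y in K, ‖locForce χ u p s y‖ ≤ ∫ y in K, (L₂ * Mu + L₁ * Mu ^ 2 + L₁ * |p s y|) :=
        setIntegral_mono_on hfi hbi measurableSet_closedBall fun y _ => norm_locForce_le' hχ hL₁ hL₂ hMu hs y
    _ = (L₂ * Mu + L₁ * Mu ^ 2) * (volume K).toReal + L₁ * ∫ y in K, |p s y| := by
        rw [integral_add hci (hpi.const_mul L₁), setIntegral_const, integral_const_mul, smul_eq_mul,
          measureReal_def, mul_comm (volume K).toReal]
    _ ≤ (L₂ * Mu + L₁ * Mu ^ 2) * (volume K).toReal + L₁ * Mp := by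
        gcongr
        exact hMp s hs

end Sizes

/-! ### The gradient part at the base time: a quantitative bound -/

section GradPart

/-- **Interpolation**: a map with `‖g‖ ≤ M` and Lipschitz constant `K` is `r`-Hölder with constant
`K^r (2M)^{1-r}` for `r ≤ 1` (private copy of the tree lemma of `CheskidovGluedCalculus.lean`,
not imported). [folklore] -/
private theorem holderWith_rpow_of_lipschitz {X G : Type*} [PseudoMetricSpace X]
    [SeminormedAddCommGroup G] {K M r : ℝ≥0} {g : X → G} (hK : LipschitzWith K g)
    (hM : ∀ x, ‖g x‖₊ ≤ M) (hr : r ≤ 1) :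
    HolderWith (K ^ (r : ℝ) * (2 * M) ^ (1 - (r : ℝ))) r g := by
  intro x y
  have hr0 : 0 ≤ (r : ℝ) := r.2
  have h1r : 0 ≤ 1 - (r : ℝ) := by simpa using hr
  have hLip : nndist (g x) (g y) ≤ K * nndist x y := by
    rw [← NNReal.coe_le_coe, NNReal.coe_mul, coe_nndist, coe_nndist]
    exact hK.dist_le_mul x y
  have hBd : nndist (g x) (g y) ≤ 2 * M := by
    rw [nndist_eq_nnnorm, two_mul]
    exact (nnnorm_sub_le _ _).trans (add_le_add (hM x) (hM y))
  have aux : ∀ {a b c : ℝ≥0}, c ≤ a → c ≤ b → c ≤ a ^ (r : ℝ) * b ^ (1 - (r : ℝ)) := by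
    intro a b c hca hcb
    have hsplit : ∀ e : ℝ≥0, e = e ^ (r : ℝ) * e ^ (1 - (r : ℝ)) := fun e => by
      rw [← NNReal.rpow_add' (by norm_num : (r : ℝ) + (1 - (r : ℝ)) ≠ 0)]
      norm_num
    rcases le_total a b with h | h
    · calc c ≤ a := hca
        _ = a ^ (r : ℝ) * a ^ (1 - (r : ℝ)) := hsplit a
        _ ≤ a ^ (r : ℝ) * b ^ (1 - (r : ℝ)) := by gcongr
    · calc c ≤ b := hcb
        _ = b ^ (r : ℝ) * b ^ (1 - (r : ℝ)) := hsplit b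
        _ ≤ a ^ (r : ℝ) * b ^ (1 - (r : ℝ)) := by gcongr
  have key : nndist (g x) (g y) ≤ (K ^ (r : ℝ) * (2 * M) ^ (1 - (r : ℝ))) * nndist x y ^ (r : ℝ) := by
    have := aux hLip hBd
    rwa [NNReal.mul_rpow, mul_right_comm] at this
  calc edist (g x) (g y) = (nndist (g x) (g y) : ℝ≥0∞) := edist_nndist _ _
    _ ≤ ((K ^ (r : ℝ) * (2 * M) ^ (1 - (r : ℝ))) * nndist x y ^ (r : ℝ) : ℝ≥0) :=
        ENNReal.coe_le_coe.2 key
    _ = ((K ^ (r : ℝ) * (2 * M) ^ (1 - (r : ℝ)) : ℝ≥0) : ℝ≥0∞) * edist x y ^ (r : ℝ) := by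
        rw [ENNReal.coe_mul, ENNReal.coe_rpow_of_nonneg _ hr0, edist_nndist]

/-- A smooth compactly supported scalar function is `½`-Hölder (with some constant). [folklore] -/
theorem exists_holderWith_half_of_contDiff {g : EuclideanSpace ℝ (Fin 3) → ℝ} (hg : ContDiff ℝ 1 g)
    (hgc : HasCompactSupport g) : ∃ C : ℝ≥0, HolderWith C (1 / 2 : ℝ≥0) g := by
  obtain ⟨K, hK⟩ := hg.lipschitzWith_of_hasCompactSupport hgc one_ne_zero
  obtain ⟨M, hM⟩ := hg.continuous.norm.bddAbove_range_of_hasCompactSupport hgc.norm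
  have hM0 : 0 ≤ M := (norm_nonneg _).trans (hM (mem_range_self 0))
  refine ⟨K ^ ((1 / 2 : ℝ≥0) : ℝ) * (2 * ⟨M, hM0⟩) ^ (1 - ((1 / 2 : ℝ≥0) : ℝ)),
    holderWith_rpow_of_lipschitz hK (fun x => ?_) (by norm_num)⟩
  rw [← NNReal.coe_le_coe, coe_nnnorm]
  exact hM (mem_range_self x)

/-- **The gradient part is small with the divergence datum**: with the Majda–Bertozzi constant
`C`, if `|∇χ·u(t)| ≤ M_g` (and `χ` is an `R = 12` cut-off, `t` a cylinder time) then
`‖b(t, y)‖ ≤ 3 C M_g (1 + 9³)` for every `y`. [cite: MajdaBertozziCUP2002, §4.1.3 (4.38)] -/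
theorem norm_locGradPart_le (hsol : IsCylinderSolution x₁ δ 12 u p) (hχ : IsLocCutoff x₁ 12 χ)
    {t : ℝ} (ht : t ∈ Ioo (-δ) ((12 : ℝ) ^ 2)) {C : ℝ}
    (hC : ∀ (a : EuclideanSpace ℝ (Fin 3)) (f : EuclideanSpace ℝ (Fin 3) → ℝ) (Cf γ : ℝ≥0) (Mf Rf : ℝ)
      (c : EuclideanSpace ℝ (Fin 3)), HolderWith Cf γ f → 0 < γ → γ < 1 → (∀ y, ‖f y‖ ≤ Mf) →
      tsupport f ⊆ closedBall c Rf → 0 ≤ Rf → ∀ x, ‖newtonGradPotential a f x‖ ≤ C * ‖a‖ * Mf * (1 + Rf ^ 3))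
    {Mg : ℝ} (hMg : ∀ y, |locDivergence χ u t y| ≤ Mg) (y : EuclideanSpace ℝ (Fin 3)) :
    ‖locGradPart χ u t y‖ ≤ 3 * (C * Mg * (1 + 9 ^ 3)) := by
  have hg : ContDiff ℝ 1 (locDivergence χ u t) := (contDiff_locDivergence hsol hχ ht).of_le (by norm_cast)
  have hgc := hasCompactSupport_locDivergence hχ (u := u) (t := t)
  obtain ⟨Cf, hHol⟩ := exists_holderWith_half_of_contDiff hg hgc
  have hsupp : tsupport (locDivergence χ u t) ⊆ closedBall x₁ 9 := by
    have h := tsupport_locDivergence_subset hχ (u := u) (t := t)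
    norm_num at h; exact h
  have hsingle : ∀ j : Fin 3, ‖EuclideanSpace.single j (1 : ℝ)‖ = 1 := fun j => by simp
  have hT : ∀ j : Fin 3, ‖newtonGradPotential (EuclideanSpace.single j (1 : ℝ)) (locDivergence χ u t) y‖ ≤
      C * Mg * (1 + 9 ^ 3) := by
    intro j
    have h := hC (EuclideanSpace.single j (1 : ℝ)) (locDivergence χ u t) Cf (1 / 2) Mg 9 x₁ hHol
      (by norm_num) (by norm_num) (fun y => by rw [Real.norm_eq_abs]; exact hMg y) hsupp (by norm_num) y
    rwa [hsingle, mul_one] at h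
  rw [locGradPart_eq_sum_newtonGradPotential hsol hχ ht y]
  calc ‖∑ j, newtonGradPotential (EuclideanSpace.single j (1 : ℝ)) (locDivergence χ u t) y •
        EuclideanSpace.single j (1 : ℝ)‖
      ≤ ∑ j, ‖newtonGradPotential (EuclideanSpace.single j (1 : ℝ)) (locDivergence χ u t) y •
        EuclideanSpace.single j (1 : ℝ)‖ := norm_sum_le _ _
    _ ≤ ∑ _j : Fin 3, C * Mg * (1 + 9 ^ 3) := Finset.sum_le_sum fun j _ => by
        rw [norm_smul, hsingle, mul_one]; exact hT j
    _ = 3 * (C * Mg * (1 + 9 ^ 3)) := by simp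

end GradPart

/-! ### The quantitative bound for `DATA_ℂ` -/

section Bound

/-- `τ ↦ (t - τ)^{-1/2}` is integrable on `(s, t)`. [folklore] -/
theorem integrableOn_Ioo_sub_rpow_neg_half (s t : ℝ) :
    IntegrableOn (fun τ => (t - τ) ^ (-(1 / 2 : ℝ))) (Ioo s t) := by
  have hii : IntervalIntegrable (fun τ => (t - τ) ^ (-(1 / 2 : ℝ))) volume s t := by
    have h := (intervalIntegral.intervalIntegrable_rpow' (a := 0) (b := t - s)
      (by norm_num : (-1 : ℝ) < -(1 / 2))).comp_sub_left t
    simp only [sub_zero, sub_sub_cancel] at h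
    exact h.symm
  exact (hii.1 : IntegrableOn _ (Ioc s t) _).mono_set Ioo_subset_Ioc_self

/-- `1/√τ = τ^{-1/2}` for `τ > 0`. [folklore] -/
theorem inv_sqrt_eq_rpow_neg_half {τ : ℝ} (hτ : 0 < τ) : (Real.sqrt τ)⁻¹ = τ ^ (-(1 / 2 : ℝ)) := by
  rw [Real.sqrt_eq_rpow, Real.rpow_neg hτ.le]

variable (hsol : IsCylinderSolution x₁ δ 12 u p) (hχ : IsLocCutoff x₁ 12 χ) {s₀ t₁ : ℝ}
  (hI : Icc s₀ t₁ ⊆ Ioo (-δ) ((12 : ℝ) ^ 2))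
  {L₁ Mu : ℝ} (hL₁ : ∀ y, ‖gradient χ y‖ ≤ L₁)
  (hMu0 : 0 ≤ Mu) (hMu : ∀ s ∈ Icc s₀ t₁, ∀ y ∈ ball x₁ 11, ‖u s y‖ ≤ Mu)
include hsol hχ hI hL₁ hMu0 hMu

omit hsol hI in
/-- **The flat bilinear slices of the datum are `O((t-s)^{-1/2})`** at admissible points:
with the constant `C` of `exists_norm_oseenFlatC_le_of_support`, for `x ∈ B(x₁,2)`,
`‖y‖ ≤ 1`, `s₀ < s < t ≤ t₁`,
`‖oseenFlatC √(t-s) (v s) ((1-χ)ũ s) (cx x + i cx y)‖ ≤ C M_u² (t-s)^{-1/2}` and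
`‖oseenFlatC √(t-s) (2∇χ) (ũ s) (cx x + i cx y)‖ ≤ C (2L₁) M_u (t-s)^{-1/2}`. [folklore] -/
theorem norm_oseenFlatC_slices_le {C : ℝ}
    (hC : ∀ {ρ : ℝ}, 0 < ρ → ∀ (x y : EuclideanSpace ℝ (Fin 3))
      {u v : EuclideanSpace ℝ (Fin 3) → EuclideanSpace ℝ (Fin 3)} {Mu Mv : ℝ}, 0 ≤ Mu → 0 ≤ Mv →
      (∀ w, ‖u w‖ ≤ Mu) → (∀ w, ‖v w‖ ≤ Mv) →
      (∀ w, u w ≠ 0 → v w ≠ 0 → ‖y‖ ≤ ‖x - w‖ / 2 + ρ) →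
        ‖oseenFlatC ρ u v (complexify x + Complex.I • complexify y)‖ ≤ C * Mu * Mv / ρ)
    {t : ℝ} (ht : t ∈ Ioc s₀ t₁) {x : EuclideanSpace ℝ (Fin 3)} (hx : x ∈ ball x₁ 2)
    {y : EuclideanSpace ℝ (Fin 3)} (hy : ‖y‖ ≤ 1) {s : ℝ} (hs : s ∈ Ioo s₀ t) :
    ‖oseenFlatC (Real.sqrt (t - s)) (locVelocity χ u s) (locFarVelocity x₁ 12 χ u s)
        (complexify x + Complex.I • complexify y)‖ ≤ C * Mu ^ 2 * (t - s) ^ (-(1 / 2 : ℝ)) ∧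
      ‖oseenFlatC (Real.sqrt (t - s)) (fun w => (2 : ℝ) • gradient χ w) (locExtension x₁ 12 u s)
        (complexify x + Complex.I • complexify y)‖ ≤ C * (2 * L₁) * Mu * (t - s) ^ (-(1 / 2 : ℝ)) := by
  have hts : 0 < t - s := sub_pos.2 hs.2
  have hρ : 0 < Real.sqrt (t - s) := Real.sqrt_pos.2 hts
  have hsI : s ∈ Icc s₀ t₁ := ⟨hs.1.le, hs.2.le.trans ht.2⟩
  have hL₁0 : 0 ≤ L₁ := (norm_nonneg _).trans (hL₁ x₁)
  have hadm : ∀ w, w ∉ ball x₁ 8 → ‖y‖ ≤ ‖x - w‖ / 2 + Real.sqrt (t - s) := by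
    intro w hw
    have hd := dist_source_ge hχ hx hw
    linarith [hρ.le]
  constructor
  · have h := hC hρ x y hMu0 hMu0 (fun w => norm_locVelocity_le' hχ hMu hsI w)
      (fun w => norm_locFarVelocity_le' hχ hMu hsI w) (fun w _ hw => hadm w fun hball =>
        hw (locFarVelocity_eq_zero_of_mem' hχ (ball_subset_closedBall hball) s))
    rw [div_eq_mul_inv, inv_sqrt_eq_rpow_neg_half hts] at h
    calc _ ≤ C * Mu * Mu * (t - s) ^ (-(1 / 2 : ℝ)) := h
      _ = C * Mu ^ 2 * (t - s) ^ (-(1 / 2 : ℝ)) := by ring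
  · have h := hC hρ x y (by positivity) hMu0 (fun w => norm_two_smul_gradient_le hχ hL₁ w)
      (fun w => norm_locExtension_le' hMu hsI w) (fun w hw _ => hadm w fun hball =>
        hw (by rw [gradient_cutoff_eq_zero_of_mem hχ hball, smul_zero]))
    rw [div_eq_mul_inv, inv_sqrt_eq_rpow_neg_half hts] at h
    exact h

end Bound

/-- **The quantitative bound for the continued datum.** For bounds `L₁, L₂ ≥ 0` of `∇χ`, `Δχ`
there is `A ≥ 0` such that: for every `R = 12` cylinder solution and cut-off with these bounds,
times `[s₀, t₁] ⊆ (-δ, 144)` with `t₁ - s₀ ≤ 1`, a bound `M_u` of `u` on `[s₀,t₁] × B(x₁,11)`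
and `M_p` of `∫_{B̄(x₁,9)}|p(s)|`, and every admissible point — `t ∈ (s₀, t₁)`, `x ∈ B(x₁,2)`,
`‖y‖ ≤ √(t-s₀)`, `‖y‖ ≤ 1` —
`‖DATA_ℂ(t, cx x + i cx y)‖ ≤ A (M_u + M_u² + M_p)`. [cite: BradshawGrujicKukavica2015, §4] -/
theorem exists_norm_locDataC_le {L₁ L₂ : ℝ} (hL₁0 : 0 ≤ L₁) (hL₂0 : 0 ≤ L₂) :
    ∃ A : ℝ, 0 ≤ A ∧ ∀ {x₁ : EuclideanSpace ℝ (Fin 3)} {δ : ℝ}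
      {u : ℝ → EuclideanSpace ℝ (Fin 3) → EuclideanSpace ℝ (Fin 3)} {p : ℝ → EuclideanSpace ℝ (Fin 3) → ℝ}
      {χ : EuclideanSpace ℝ (Fin 3) → ℝ} {s₀ t₁ Mu Mp : ℝ},
      IsCylinderSolution x₁ δ 12 u p → IsLocCutoff x₁ 12 χ →
      (∀ y, ‖gradient χ y‖ ≤ L₁) → (∀ y, |(Δ χ) y| ≤ L₂) →
      Icc s₀ t₁ ⊆ Ioo (-δ) ((12 : ℝ) ^ 2) → t₁ - s₀ ≤ 1 → 0 ≤ Mu →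
      (∀ s ∈ Icc s₀ t₁, ∀ y ∈ ball x₁ 11, ‖u s y‖ ≤ Mu) → 0 ≤ Mp →
      (∀ s ∈ Icc s₀ t₁, ∫ y in closedBall x₁ 9, |p s y| ≤ Mp) →
      ∀ ⦃t : ℝ⦄, t ∈ Ioo s₀ t₁ → ∀ ⦃x : EuclideanSpace ℝ (Fin 3)⦄, x ∈ ball x₁ 2 →
      ∀ ⦃y : EuclideanSpace ℝ (Fin 3)⦄, ‖y‖ ≤ Real.sqrt (t - s₀) → ‖y‖ ≤ 1 →
        ‖locDataC x₁ 12 χ u p s₀ t (complexify x + Complex.I • complexify y)‖ ≤ A * (Mu + Mu ^ 2 + Mp) := by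
  -- the absolute constants
  obtain ⟨CMB, hCMB0, hMB⟩ := exists_newtonGradPotential_bounds (F := ℝ)
  obtain ⟨C₃, hC₃, hT3⟩ := exists_norm_oseenFlatC_le_of_support (ι := Fin 3)
  obtain ⟨C₄, hC₄0, hT4⟩ := exists_forall_norm_lerayHeatPotC_le (ι := Fin 3) (D := 6) (by norm_num)
    (ρ₁ := 1) one_pos
  set V₉ : ℝ := (volume (closedBall (0 : EuclideanSpace ℝ (Fin 3)) 9)).toReal with hV₉
  set K₂ : ℝ := Real.exp 2 * (25 / 6 : ℝ) ^ ((Fintype.card (Fin 3) : ℝ) / 2) with hK₂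
  -- coefficients of `Mu`, `Mu²`, `Mp`
  set aMu : ℝ := (36 : ℝ)⁻¹ * L₁ * V₉ + K₂ * (1 + 3 * (CMB * L₁ * (1 + 9 ^ 3))) + C₃ * (2 * L₁) * 2 +
    C₄ * (L₂ * V₉) with haMu
  set aMu2 : ℝ := C₃ * 2 + C₄ * (L₁ * V₉) with haMu2
  set aMp : ℝ := C₄ * L₁ with haMp
  refine ⟨aMu + aMu2 + aMp, by positivity, ?_⟩
  intro x₁ δ u p χ s₀ t₁ Mu Mp hsol hχ hL₁ hL₂ hI hT hMu0 hMu hMp0 hMp t ht x hx y hyρ hy1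
  have hvol : (volume (closedBall x₁ 9)).toReal = V₉ := by
    rw [hV₉, Measure.addHaar_closedBall_center]
  have hst : s₀ < t := ht.1
  have htI : t ∈ Ioo (-δ) ((12 : ℝ) ^ 2) := hI ⟨ht.1.le, ht.2.le⟩
  have hs₀I : s₀ ∈ Ioo (-δ) ((12 : ℝ) ^ 2) := hI ⟨le_rfl, (ht.1.trans ht.2).le⟩
  have hts₀ : 0 < t - s₀ := sub_pos.2 hst
  have hts₀1 : t - s₀ ≤ 1 := by linarith [ht.2]
  have hsqrt1 : Real.sqrt (t - s₀) ≤ 1 := by rw [Real.sqrt_le_one]; exact hts₀1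
  have hy3 : ‖y‖ ≤ 6 / 2 := by linarith
  -- `T1`
  have h1 : ‖newtonGradPotentialC (locDivergence χ u t) (complexify x + Complex.I • complexify y)‖ ≤
      (36 : ℝ)⁻¹ * L₁ * V₉ * Mu := by
    have hg := (contDiff_locDivergence hsol hχ htI).continuous
    have hgc := hasCompactSupport_locDivergence hχ (u := u) (t := t)
    have hsupp : ∀ w ∈ tsupport (locDivergence χ u t), (6 : ℝ) ≤ ‖x - w‖ := by
      intro w hw
      refine dist_source_ge hχ hx fun hball => ?_
      have hzero : ∀ᶠ z in 𝓝 w, locDivergence χ u t z = 0 := by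
        filter_upwards [isOpen_ball.mem_nhds hball] with z hz using locDivergence_eq_zero_of_mem' hχ hz t
      exact (notMem_tsupport_iff_eventuallyEq.2 hzero) hw
    have h := norm_newtonGradPotentialC_le hg hgc (by norm_num : (0 : ℝ) < 6) hy3 hsupp
    refine h.trans ?_
    have hint : ∫ w, |locDivergence χ u t w| ≤ L₁ * Mu * V₉ := by
      have h0 : ∀ w ∉ closedBall x₁ 9, |locDivergence χ u t w| = 0 := fun w hw => by
        have hw' : w ∉ tsupport (locDivergence χ u t) := fun h => hw (by
          have h' := tsupport_locDivergence_subset hχ (u := u) (t := t) h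
          norm_num at h'; exact h')
        rw [image_eq_zero_of_notMem_tsupport hw', abs_zero]
      rw [← setIntegral_eq_integral_of_forall_compl_eq_zero h0]
      have hKvol : volume (closedBall x₁ 9) < (⊤ : ℝ≥0∞) := (isCompact_closedBall _ _).measure_lt_top
      calc ∫ w in closedBall x₁ 9, |locDivergence χ u t w| ≤ ∫ _ in closedBall x₁ 9, L₁ * Mu := by
            refine setIntegral_mono_on (hg.abs.continuousOn.integrableOn_compact (isCompact_closedBall _ _))
              (integrableOn_const hKvol.ne) measurableSet_closedBall fun w _ => ?_
            exact abs_locDivergence_le hχ hL₁ hMu ⟨ht.1.le, ht.2.le⟩ w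
        _ = L₁ * Mu * V₉ := by rw [setIntegral_const, smul_eq_mul, mul_comm, Measure.real, hvol]
    calc (6 ^ 2 : ℝ)⁻¹ * ∫ w, |locDivergence χ u t w| ≤ (6 ^ 2 : ℝ)⁻¹ * (L₁ * Mu * V₉) := by gcongr
      _ = (36 : ℝ)⁻¹ * L₁ * V₉ * Mu := by norm_num; ring
  -- `T2`
  have h2 : ‖heatPotentialC (Real.sqrt (t - s₀)) (locSolPart χ u s₀) (complexify x + Complex.I • complexify y)‖ ≤
      K₂ * (1 + 3 * (CMB * L₁ * (1 + 9 ^ 3))) * Mu := by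
    have hMg : ∀ w, |locDivergence χ u s₀ w| ≤ L₁ * Mu := fun w =>
      abs_locDivergence_le hχ hL₁ hMu ⟨le_rfl, (ht.1.trans ht.2).le⟩ w
    have hb : ∀ w, ‖locGradPart χ u s₀ w‖ ≤ 3 * (CMB * (L₁ * Mu) * (1 + 9 ^ 3)) := fun w =>
      norm_locGradPart_le hsol hχ hs₀I (fun a f Cf γ Mf Rf c hH hγ hγ1 hMf hsf hRf =>
        (hMB a f Cf γ Mf Rf c hH hγ hγ1 hMf hsf hRf).1) hMg w
    have ha : ∀ w, ‖locSolPart χ u s₀ w‖ ≤ (1 + 3 * (CMB * L₁ * (1 + 9 ^ 3))) * Mu := by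
      intro w
      rw [locSolPart_apply]
      calc ‖locVelocity χ u s₀ w - locGradPart χ u s₀ w‖ ≤ Mu + 3 * (CMB * (L₁ * Mu) * (1 + 9 ^ 3)) :=
            (norm_sub_le _ _).trans (add_le_add (norm_locVelocity_le' hχ hMu ⟨le_rfl, (ht.1.trans ht.2).le⟩ w) (hb w))
        _ = (1 + 3 * (CMB * L₁ * (1 + 9 ^ 3))) * Mu := by ring
    have h := norm_heatPotentialC_le (ι := Fin 3) (by positivity) ha (Real.sqrt_pos.2 hts₀) hyρ (x := x)
    calc _ ≤ K₂ * ((1 + 3 * (CMB * L₁ * (1 + 9 ^ 3))) * Mu) := h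
      _ = K₂ * (1 + 3 * (CMB * L₁ * (1 + 9 ^ 3))) * Mu := by ring
  -- `T3`
  have h3 : ‖oseenDuhamelFlatC s₀ (locVelocity χ u) (locFarVelocity x₁ 12 χ u) t
      (complexify x + Complex.I • complexify y)‖ ≤ C₃ * 2 * Mu ^ 2 ∧
      ‖oseenDuhamelFlatC s₀ (fun _ w => (2 : ℝ) • gradient χ w) (locExtension x₁ 12 u) t
      (complexify x + Complex.I • complexify y)‖ ≤ C₃ * (2 * L₁) * 2 * Mu := by
    have hsl := fun s (hs : s ∈ Ioo s₀ t) =>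
      norm_oseenFlatC_slices_le hχ hL₁ hMu0 hMu (fun hρ x y _ _ _ _ hMu hMv hu hv hadm =>
        hT3 hρ x y hMu hMv hu hv hadm) ⟨ht.1, ht.2.le⟩ hx hy1 hs
    constructor
    · have h := norm_oseenDuhamelFlatC_le_of_forall hst (K := C₃ * Mu ^ 2) (by positivity)
        (u := locVelocity χ u) (v := locFarVelocity x₁ 12 χ u) (ζ := complexify x + Complex.I • complexify y)
        fun s hs => (hsl s hs).1
      calc _ ≤ C₃ * Mu ^ 2 * (2 * Real.sqrt (t - s₀)) := h
        _ ≤ C₃ * Mu ^ 2 * (2 * 1) := by gcongr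
        _ = C₃ * 2 * Mu ^ 2 := by ring
    · have h := norm_oseenDuhamelFlatC_le_of_forall hst (K := C₃ * (2 * L₁) * Mu) (by positivity)
        (u := fun _ w => (2 : ℝ) • gradient χ w) (v := locExtension x₁ 12 u)
        (ζ := complexify x + Complex.I • complexify y) fun s hs => (hsl s hs).2
      calc _ ≤ C₃ * (2 * L₁) * Mu * (2 * Real.sqrt (t - s₀)) := h
        _ ≤ C₃ * (2 * L₁) * Mu * (2 * 1) := by gcongr
        _ = C₃ * (2 * L₁) * 2 * Mu := by ring
  -- `T4`
  have h4 : ‖lerayHeatForcingC s₀ (locForce χ u p) t (complexify x + Complex.I • complexify y)‖ ≤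
      C₄ * ((L₂ * Mu + L₁ * Mu ^ 2) * V₉ + L₁ * Mp) := by
    set Af : ℝ := (L₂ * Mu + L₁ * Mu ^ 2) * V₉ + L₁ * Mp with hAf
    have hpt : ∀ s ∈ Ioo s₀ t, ‖lerayHeatPotC (Real.sqrt (t - s)) (locForce χ u p s)
        (complexify x + Complex.I • complexify y)‖ ≤ C₄ * Af := by
      intro s hs
      have hsI' : s ∈ Icc s₀ t₁ := ⟨hs.1.le, (hs.2.trans ht.2).le⟩
      have hρ : 0 < Real.sqrt (t - s) := Real.sqrt_pos.2 (sub_pos.2 hs.2)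
      have hρ1 : Real.sqrt (t - s) ≤ 1 := by
        rw [Real.sqrt_le_one]; linarith [hs.1]
      have hfi : Integrable (locForce χ u p s) :=
        (contDiff_locForce hsol hχ (hI hsI')).continuous.integrable_of_hasCompactSupport (hasCompactSupport_locForce hχ)
      have h := hT4 hρ hρ1 x y hfi (fun w hw => dist_source_ge hχ hx fun hball =>
        hw (locForce_eq_zero_of_mem hχ hball s)) hy3
      refine h.trans (mul_le_mul_of_nonneg_left ?_ hC₄0)
      have := integral_norm_locForce_le' hsol hχ hI hL₁ hL₂ hMu hMp hsI'
      rwa [hvol] at this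
    have h := norm_lerayHeatForcingC_le_of_forall hst.le hpt
    calc _ ≤ C₄ * Af * (t - s₀) := h
      _ ≤ C₄ * Af * 1 := by
          refine mul_le_mul_of_nonneg_left hts₀1 ?_
          positivity
      _ = C₄ * Af := mul_one _
  -- assemble
  rw [locDataC_apply]
  have hMu1 : Mu ≤ Mu + Mu ^ 2 + Mp := by nlinarith
  have hMu2 : Mu ^ 2 ≤ Mu + Mu ^ 2 + Mp := by nlinarith
  have hMp1 : Mp ≤ Mu + Mu ^ 2 + Mp := by nlinarith
  calc _ ≤ ‖newtonGradPotentialC (locDivergence χ u t) (complexify x + Complex.I • complexify y)‖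
        + ‖heatPotentialC (Real.sqrt (t - s₀)) (locSolPart χ u s₀) (complexify x + Complex.I • complexify y)‖
        + ‖oseenDuhamelFlatC s₀ (locVelocity χ u) (locFarVelocity x₁ 12 χ u) t (complexify x + Complex.I • complexify y)‖
        + ‖oseenDuhamelFlatC s₀ (fun _ w => (2 : ℝ) • gradient χ w) (locExtension x₁ 12 u) t (complexify x + Complex.I • complexify y)‖
        + ‖lerayHeatForcingC s₀ (locForce χ u p) t (complexify x + Complex.I • complexify y)‖ := by
          refine (norm_add_le _ _).trans (add_le_add ((norm_sub_le _ _).trans (add_le_add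
            ((norm_sub_le _ _).trans (add_le_add (norm_add_le _ _) le_rfl)) le_rfl)) le_rfl)
    _ ≤ (36 : ℝ)⁻¹ * L₁ * V₉ * Mu + K₂ * (1 + 3 * (CMB * L₁ * (1 + 9 ^ 3))) * Mu + C₃ * 2 * Mu ^ 2
        + C₃ * (2 * L₁) * 2 * Mu + C₄ * ((L₂ * Mu + L₁ * Mu ^ 2) * V₉ + L₁ * Mp) := by
          linarith [h1, h2, h3.1, h3.2, h4]
    _ = aMu * Mu + aMu2 * Mu ^ 2 + aMp * Mp := by rw [haMu, haMu2, haMp]; ring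
    _ ≤ aMu * (Mu + Mu ^ 2 + Mp) + aMu2 * (Mu + Mu ^ 2 + Mp) + aMp * (Mu + Mu ^ 2 + Mp) := by
          gcongr
    _ = (aMu + aMu2 + aMp) * (Mu + Mu ^ 2 + Mp) := by ring

/-! ### Holomorphy of `DATA_ℂ` on admissible open sets -/

section Holomorphy

/-- The real parts of two decomposed points differ by at most the distance of the points.
[folklore] -/
theorem norm_re_sub_re_le (x y x' y' : EuclideanSpace ℝ (Fin 3)) :
    ‖x - x'‖ ≤ ‖(complexify x + Complex.I • complexify y) - (complexify x' + Complex.I • complexify y')‖ := by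
  have heq : (complexify x + Complex.I • complexify y) - (complexify x' + Complex.I • complexify y') =
      complexify (x - x') + Complex.I • complexify (y - y') := by
    rw [map_sub, map_sub, smul_sub]; abel
  rw [heq]
  refine norm_le_of_forall_abs_le_norm_apply fun i => ?_
  rw [← re_complexify_add_I_smul_complexify_apply (x - x') (y - y') i]
  exact Complex.abs_re_le_norm _

variable (hsol : IsCylinderSolution x₁ δ 12 u p) (hχ : IsLocCutoff x₁ 12 χ) {s₀ t₁ : ℝ}
  (hI : Icc s₀ t₁ ⊆ Ioo (-δ) ((12 : ℝ) ^ 2)) (hT : t₁ - s₀ ≤ 1)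
  {L₁ Mu : ℝ} (hL₁ : ∀ y, ‖gradient χ y‖ ≤ L₁)
  (hMu0 : 0 ≤ Mu) (hMu : ∀ s ∈ Icc s₀ t₁, ∀ y ∈ ball x₁ 11, ‖u s y‖ ≤ Mu)
include hsol hχ hI hT hL₁ hMu0 hMu

/-- **`DATA_ℂ(t, ·)` is holomorphic on every open set of admissible points** (`t ∈ (s₀, t₁)`):
points `cx x + i cx y` with `x ∈ B(x₁, 2)`, `‖y‖ ≤ √(t - s₀)`, `‖y‖ ≤ 1`. [cite: BradshawGrujicKukavica2015, §4] -/
theorem differentiableOn_locDataC {t : ℝ} (ht : t ∈ Ioo s₀ t₁) {V : Set (EuclideanSpace ℂ (Fin 3))}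
    (hV : IsOpen V)
    (hadm : ∀ ζ ∈ V, ∃ x y : EuclideanSpace ℝ (Fin 3), ζ = complexify x + Complex.I • complexify y ∧
      x ∈ ball x₁ 2 ∧ ‖y‖ ≤ Real.sqrt (t - s₀) ∧ ‖y‖ ≤ 1) :
    DifferentiableOn ℂ (locDataC x₁ 12 χ u p s₀ t) V := by
  obtain ⟨C₃, hC₃, hT3⟩ := exists_norm_oseenFlatC_le_of_support (ι := Fin 3)
  obtain ⟨C₄, hC₄0, hT4⟩ := exists_forall_norm_lerayHeatPotC_le (ι := Fin 3) (D := 6) (by norm_num)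
    (ρ₁ := 1) one_pos
  have hst : s₀ < t := ht.1
  have htI : t ∈ Ioo (-δ) ((12 : ℝ) ^ 2) := hI ⟨ht.1.le, ht.2.le⟩
  have hts₀ : 0 < t - s₀ := sub_pos.2 hst
  have hIt : Icc s₀ t ⊆ Ioo (-δ) ((12 : ℝ) ^ 2) := fun s hs => hI ⟨hs.1, hs.2.trans ht.2.le⟩
  -- `T1`
  have h1 : DifferentiableOn ℂ (newtonGradPotentialC (locDivergence χ u t)) V := by
    refine differentiableOn_newtonGradPotentialC (contDiff_locDivergence hsol hχ htI).continuous
      (hasCompactSupport_locDivergence hχ) (by norm_num : (0 : ℝ) < 6) hV fun ζ hζ => ?_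
    obtain ⟨x, y, rfl, hx, -, hy1⟩ := hadm ζ hζ
    refine ⟨x, y, rfl, by linarith, fun w hw => dist_source_ge hχ hx fun hball => ?_⟩
    have hzero : ∀ᶠ z in 𝓝 w, locDivergence χ u t z = 0 := by
      filter_upwards [isOpen_ball.mem_nhds hball] with z hz using locDivergence_eq_zero_of_mem' hχ hz t
    exact (notMem_tsupport_iff_eventuallyEq.2 hzero) hw
  -- local reduction: it suffices to work on `V ∩ ball ζ₀ 1`
  have hloc : ∀ {f : EuclideanSpace ℂ (Fin 3) → EuclideanSpace ℂ (Fin 3)},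
      (∀ x₀ : EuclideanSpace ℝ (Fin 3), ∀ V' : Set (EuclideanSpace ℂ (Fin 3)), IsOpen V' →
        (∀ ζ ∈ V', ∃ x y : EuclideanSpace ℝ (Fin 3), ζ = complexify x + Complex.I • complexify y ∧
          x ∈ ball x₁ 2 ∧ ‖y‖ ≤ Real.sqrt (t - s₀) ∧ ‖y‖ ≤ 1 ∧ ‖x - x₀‖ ≤ 1) → DifferentiableOn ℂ f V') →
      DifferentiableOn ℂ f V := by
    intro f hf ζ₀ hζ₀
    obtain ⟨x₀, y₀, rfl, -, -, -⟩ := hadm _ hζ₀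
    set V' := V ∩ ball (complexify x₀ + Complex.I • complexify y₀) 1 with hV'
    have hV'o : IsOpen V' := hV.inter isOpen_ball
    have hmem : complexify x₀ + Complex.I • complexify y₀ ∈ V' := ⟨hζ₀, mem_ball_self one_pos⟩
    have hd := hf x₀ V' hV'o fun ζ hζ => by
      obtain ⟨x, y, rfl, hx, hyρ, hy1⟩ := hadm ζ hζ.1
      refine ⟨x, y, rfl, hx, hyρ, hy1, ?_⟩
      have hb := mem_ball.1 hζ.2
      rw [dist_eq_norm] at hb
      exact (norm_re_sub_re_le x y x₀ y₀).trans hb.le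
    exact (hd.differentiableAt (hV'o.mem_nhds hmem)).differentiableWithinAt
  -- `T2`
  have h2 : DifferentiableOn ℂ (heatPotentialC (Real.sqrt (t - s₀)) (locSolPart χ u s₀)) V := by
    have hs₀I : s₀ ∈ Ioo (-δ) ((12 : ℝ) ^ 2) := hI ⟨le_rfl, (ht.1.trans ht.2).le⟩
    obtain ⟨Ca, hCa⟩ := exists_forall_norm_locSolPart_le hsol hχ hs₀I
    have hameas : AEStronglyMeasurable (locSolPart χ u s₀) volume :=
      (contDiff_locSolPart hsol hχ hs₀I).continuous.aestronglyMeasurable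
    refine hloc fun x₀ V' hV' hadm' => differentiableOn_heatPotentialC hameas hCa (Real.sqrt_pos.2 hts₀) x₀ hV'
      fun ζ hζ => ?_
    obtain ⟨x, y, rfl, -, hyρ, -, hxx₀⟩ := hadm' ζ hζ
    exact ⟨x, y, rfl, hyρ, hxx₀⟩
  -- `T3`: slab data on `(s₀, t)`
  have hmv := aestronglyMeasurable_uncurry_locVelocity hsol hχ hIt (s₀ := s₀) (t := t)
  have hmf := aestronglyMeasurable_uncurry_locFarVelocity hsol hχ hIt (s₀ := s₀) (t₁ := t)
  have hme := aestronglyMeasurable_uncurry_locExtension hsol hIt (s₀ := s₀) (t := t) (x₁ := x₁)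
  have hmg := aestronglyMeasurable_uncurry_gradCutoff hχ (Ioo s₀ t ×ˢ (univ : Set (EuclideanSpace ℝ (Fin 3))))
  have hL₁0 : 0 ≤ L₁ := (norm_nonneg _).trans (hL₁ x₁)
  set M₃ : ℝ := max Mu (2 * L₁) with hM₃
  have hM₃0 : 0 ≤ M₃ := hMu0.trans (le_max_left _ _)
  have hvM : ∀ s ∈ Ioo s₀ t, ∀ w, ‖locVelocity χ u s w‖ ≤ M₃ := fun s hs w =>
    (norm_locVelocity_le' hχ hMu ⟨hs.1.le, hs.2.le.trans ht.2.le⟩ w).trans (le_max_left _ _)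
  have hfM : ∀ s ∈ Ioo s₀ t, ∀ w, ‖locFarVelocity x₁ 12 χ u s w‖ ≤ M₃ := fun s hs w =>
    (norm_locFarVelocity_le' hχ hMu ⟨hs.1.le, hs.2.le.trans ht.2.le⟩ w).trans (le_max_left _ _)
  have heM : ∀ s ∈ Ioo s₀ t, ∀ w, ‖locExtension x₁ 12 u s w‖ ≤ M₃ := fun s hs w =>
    (norm_locExtension_le' hMu ⟨hs.1.le, hs.2.le.trans ht.2.le⟩ w).trans (le_max_left _ _)
  have hgM : ∀ s ∈ Ioo s₀ t, ∀ w, ‖(2 : ℝ) • gradient χ w‖ ≤ M₃ := fun s _ w =>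
    (norm_two_smul_gradient_le hχ hL₁ w).trans (le_max_right _ _)
  have hbi : IntegrableOn (fun s => C₃ * (2 * L₁ + Mu) * Mu * (t - s) ^ (-(1 / 2 : ℝ))) (Ioo s₀ t) :=
    (integrableOn_Ioo_sub_rpow_neg_half s₀ t).const_mul _
  have hsl := fun {x : EuclideanSpace ℝ (Fin 3)} (hx : x ∈ ball x₁ 2) {y : EuclideanSpace ℝ (Fin 3)}
    (hy : ‖y‖ ≤ 1) (s : ℝ) (hs : s ∈ Ioo s₀ t) =>
      norm_oseenFlatC_slices_le hχ hL₁ hMu0 hMu (fun hρ x y _ _ _ _ hMu hMv hu hv hadm =>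
        hT3 hρ x y hMu hMv hu hv hadm) ⟨ht.1, ht.2.le⟩ hx hy hs
  have h3a : DifferentiableOn ℂ (oseenDuhamelFlatC s₀ (locVelocity χ u) (locFarVelocity x₁ 12 χ u) t) V := by
    refine hloc fun x₀ V' hV' hadm' => differentiableOn_oseenDuhamelFlatC hmv hmf hM₃0 hvM hfM x₀ zero_le_one hV'
      (fun ζ hζ => ?_) hbi (fun ζ hζ s hs => ?_)
    · obtain ⟨x, y, rfl, -, -, hy1, hxx₀⟩ := hadm' ζ hζ
      exact ⟨x, y, rfl, hxx₀, hy1⟩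
    · obtain ⟨x, y, rfl, hx, -, hy1, -⟩ := hadm' ζ hζ
      refine ((hsl hx hy1 s hs).1).trans ?_
      have hr : 0 ≤ (t - s) ^ (-(1 / 2 : ℝ)) := Real.rpow_nonneg (sub_pos.2 hs.2).le _
      have : C₃ * Mu ^ 2 ≤ C₃ * (2 * L₁ + Mu) * Mu := by
        nlinarith [mul_nonneg (mul_nonneg hC₃.le hMu0) hMu0, mul_nonneg (mul_nonneg hC₃.le hL₁0) hMu0]
      exact mul_le_mul_of_nonneg_right this hr
  have h3b : DifferentiableOn ℂ (oseenDuhamelFlatC s₀ (fun _ w => (2 : ℝ) • gradient χ w) (locExtension x₁ 12 u) t) V := by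
    refine hloc fun x₀ V' hV' hadm' => differentiableOn_oseenDuhamelFlatC hmg hme hM₃0 hgM heM x₀ zero_le_one hV'
      (fun ζ hζ => ?_) hbi (fun ζ hζ s hs => ?_)
    · obtain ⟨x, y, rfl, -, -, hy1, hxx₀⟩ := hadm' ζ hζ
      exact ⟨x, y, rfl, hxx₀, hy1⟩
    · obtain ⟨x, y, rfl, hx, -, hy1, -⟩ := hadm' ζ hζ
      refine ((hsl hx hy1 s hs).2).trans ?_
      have hr : 0 ≤ (t - s) ^ (-(1 / 2 : ℝ)) := Real.rpow_nonneg (sub_pos.2 hs.2).le _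
      have : C₃ * (2 * L₁) * Mu ≤ C₃ * (2 * L₁ + Mu) * Mu := by
        nlinarith [mul_nonneg (mul_nonneg hC₃.le hMu0) hMu0, mul_nonneg (mul_nonneg hC₃.le hL₁0) hMu0]
      exact mul_le_mul_of_nonneg_right this hr
  -- `T4`
  have h4 : DifferentiableOn ℂ (lerayHeatForcingC s₀ (locForce χ u p) t) V := by
    have hGm : AEStronglyMeasurable (uncurry (locForce χ u p))
        ((volume : Measure (ℝ × EuclideanSpace ℝ (Fin 3))).restrict (Ioo s₀ t ×ˢ univ)) :=
      ((isSmoothSpaceTimeOn_locForce hsol hχ).continuousOn.mono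
        (prod_mono (Ioo_subset_Icc_self.trans hIt) subset_rfl)).aestronglyMeasurable
        (measurableSet_Ioo.prod MeasurableSet.univ)
    -- an `L¹` bound for `f₀` on `[s₀, t]` (qualitative suffices here)
    obtain ⟨Af, -, hAf⟩ := exists_forall_integral_norm_locForce_le hsol hχ hIt
    refine differentiableOn_lerayHeatForcingC hGm (fun s hs => (contDiff_locForce hsol hχ (hIt (Ioo_subset_Icc_self hs))).continuous)
      (fun s _ => hasCompactSupport_locForce hχ) hV (bound := fun _ => C₄ * Af)
      (integrableOn_const (by rw [Real.volume_Ioo]; exact ENNReal.ofReal_ne_top)) fun ζ hζ s hs => ?_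
    obtain ⟨x, y, rfl, hx, -, hy1⟩ := hadm ζ hζ
    have hρ : 0 < Real.sqrt (t - s) := Real.sqrt_pos.2 (sub_pos.2 hs.2)
    have hρ1 : Real.sqrt (t - s) ≤ 1 := by
      rw [Real.sqrt_le_one]; linarith [hs.1, ht.2]
    have hfi : Integrable (locForce χ u p s) :=
      (contDiff_locForce hsol hχ (hIt (Ioo_subset_Icc_self hs))).continuous.integrable_of_hasCompactSupport
        (hasCompactSupport_locForce hχ)
    have h := hT4 hρ hρ1 x y hfi (fun w hw => dist_source_ge hχ hx fun hball =>
      hw (locForce_eq_zero_of_mem hχ hball s)) (by linarith)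
    exact h.trans (mul_le_mul_of_nonneg_left (hAf s (Ioo_subset_Icc_self hs)) hC₄0)
  have hsum := (((h1.add h2).sub h3a).sub h3b).add h4
  refine hsum.congr fun ζ _ => ?_
  simp only [locDataC_apply, Pi.add_apply, Pi.sub_apply]

end Holomorphy

end BGK2015

end Literature.Analysis.FluidPDE
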